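import Literature.AlgebraicGeometry.Milne1999.HodgeGroupFiniteProductsPowers
import Literature.AlgebraicGeometry.Milne1999.HodgeGroupProductsSplitting
import HarnessLib

/-!
# The restriction homomorphism `Hg(X × Y) → Hg(X) × Hg(Y)`: injective always, bijective iff `Hg(X × Y) = Hg(X) × Hg(Y)` (iff the Moonen–Zarhin (3.1) span condition); `Hg(⨁ᵢ Aᵢ) ↪ ∏ᵢ Hg(Aᵢ)` and `Hg(X) ↪ ∏ᵢ Hg(Aᵢ)` for `X ∼ ⨁ᵢ Aᵢ^{rᵢ+1}` (Moonen–Zarhin 1999 §3 (3.1) first sentence, Tannaka-free, on the real carriers)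

Family `hodge`, layer `Literature/AlgebraicGeometry/Milne1999`, namespace `Literature.AlgebraicGeometry.Milne1999` (D-0022).
THEOREMS ONLY (no definition, no named fact, no `sorry`; net debt 0). Sequel of `Milne1999/HodgeGroupProductsSplitting` (every
element of `Hg(B × C)(ℂ)` is `⋀•(u ⊕ v)` with Hodge blocks; the (3.1) criterion) and of `Milne1999/HodgeGroupFiniteProductsPowers`
(`Hg(⨁ᵢ Aᵢ^{rᵢ+1}) ≅ Hg(⨁ᵢ Aᵢ)`), written by the `lit-hodgefound` prover seat p21 (generation 35, row #9): the Hodge-group companion of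
`Milne1999/LefschetzGroupProductsRestriction` / `LefschetzGroupFiniteProductsRestriction` (the same for Milne's `L`).

## Source, verbatim

B. Moonen, Yu. G. Zarhin, *Hodge classes on abelian varieties of low dimension*, Math. Ann. 315 (1999) [held: `paper:arxiv-math_9901113`,
chunk p0006 L24–L61], §3 (3.1): «Let `X_1` and `X_2` be complex abelian varieties. Write `X = X_1 × X_2`. Then `Hg(X)` is an algebraic
subgroup of `Hg(X_1) × Hg(X_2)`. The two projections `pr_i : Hg(X) → Hg(X_i)` are surjective. […] We may have that
`Hg(X_1 × X_2) ≠ Hg(X_1) × Hg(X_2)`. (1) […] This holds if and only if for some `m` and `n` the Hodge ring `B(X_1^m × X_2^n)` is not generated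
by the elements coming from `B(X_1^m)` and `B(X_2^n)`.» J. S. Milne, *Lefschetz classes on abelian varieties*, Duke Math. J. 96 (1999), §1
p. 643: «Let `A = A_1 × ⋯ × A_s`. Then `C(A) ⊂ C(A_1) × ⋯ × C(A_s)`».

## Dictionary (all objects pre-existing; nothing is defined here)

`Hg(Y)(ℂ) = HodgeTheory.hodgeGroup (dim Y) Y.X` (Tannaka-free: the Künneth families on the powers fixing the rational `(p,p)`-classes),
`Hg(Y)(ℂ)|_{H¹} = VanGeemen1994.hodgeGroupOne`; `s ⊕ t = prodBlockDiagEquiv s t` on `H¹(X × Y)`, `⋀•U = exteriorPullbackEquiv … U`;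
«`Hg(X × Y)` SPLITS» is said inline as in `HodgeGroupProductsSplitting`: `∀ u ∈ Hg(X)|_{H¹}, ∀ v ∈ Hg(Y)|_{H¹}, ⋀•(u ⊕ v) ∈ Hg(X × Y)`;
`HodgeClassesProductSpan B C` (`HodgeTheory/HodgeGroupProductCMFactor`); `⨁ A`, `biproductSuccSplit(Inv)`, `Y^{r+1} = Y.powSucc r`.

## What is proved

* §1 **THE RESTRICTION HOMOMORPHISM `ρ : Hg(X × Y)(ℂ) → Hg(X)(ℂ) × Hg(Y)(ℂ)`** for ARBITRARY `X`, `Y` (`exists_hodgeGroup_prod_restrictHom`: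
  `g₁ = ρ(g)₁,₁ ⊕ ρ(g)₂,₁`), unique (`hodgeGroup_prod_restrictHom_unique`), INJECTIVE (`hodgeGroup_prod_restrictHom_injective` — «`Hg(X)`
  is an algebraic subgroup of `Hg(X_1) × Hg(X_2)`» on the complex points).
* §2 **`ρ` IS SURJECTIVE IFF `Hg(X × Y)` SPLITS** (`hodgeGroup_prod_restrictHom_surjective_iff`), **IFF THE (3.1) SPAN CONDITION HOLDS FOR
  ALL `X^{a+1} × Y^{a+1}`** (`hodgeGroup_prod_restrictHom_surjective_iff_forall_hodgeClassesProductSpan_powSucc`); under splitting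
  `Hg(X × Y)(ℂ) ≅ Hg(X)(ℂ) × Hg(Y)(ℂ)` (`nonempty_hodgeGroup_prod_mulEquiv_prod_of_forall`).
* §3 **EVERY NUMBER OF FACTORS**: an injective homomorphism `Hg(⨁ᵢ Aᵢ)(ℂ) → ∏ᵢ Hg(Aᵢ)(ℂ)` for every `A : Fin (n+1) → AbelianVariety ℂ`
  (`exists_hodgeGroup_biproduct_restrictHom`, induction over `⨁ A ∼ A₀ × ⨁_{i≥1} Aᵢ`), and `Hg(X)(ℂ) ↪ ∏ᵢ Hg(Aᵢ)(ℂ)` for every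
  `X ∼ ⨁ᵢ Aᵢ^{rᵢ+1}` (`exists_hodgeGroup_restrictHom_of_isIsogenous_biproduct_powSucc`); hence `Hg(X)` is commutative as soon as every
  `Hg(Aᵢ)` is (`forall_mul_comm_hodgeGroup_of_forall_of_isIsogenous_biproduct_powSucc`).

## What is NOT here (honest column)

«The two projections `pr_i : Hg(X) → Hg(X_i)` are surjective» is NOT proved: on the Tannaka-free carriers it needs Deligne's
description of `Hg` as the exact stabiliser (reductivity / Chevalley), which the tree does not have; nor are these statements about
algebraic groups over `ℚ`. PRESEARCH (2026-08-28): corpus `paper:arxiv-math_9901113` §3 re-read (chunk p0006); tree: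
`rg 'restrictHom' Literature/AlgebraicGeometry/Milne1999` finds only the `L` files of this seat; `HodgeGroupProductsSplitting` has the block
statement `exists_eq_prodBlockDiagEquiv_of_mem_hodgeGroup_prod` but no homomorphism; certification on the carriers, no novelty claimed.

## References

* [MoonenZarhin1999LowDim] B. Moonen, Yu. G. Zarhin, Hodge classes on abelian varieties of low dimension, Math. Ann. 315 (1999): §1, §3 (3.1).
* [Milne1999LefschetzClasses] J. S. Milne, Lefschetz classes on abelian varieties, Duke Math. J. 96 (1999): §1 p. 643.
* [vanGeemen1994HodgeAV] B. van Geemen, An introduction to the Hodge conjecture for abelian varieties, LNM 1594 (1994): 6.4–6.5.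
* [MumfordAV1970] D. Mumford, Abelian Varieties (1970): §19.
-/

noncomputable section

open CategoryTheory CategoryTheory.Limits
open Literature.AlgebraicTopology.SingularHomology
open Literature.AlgebraicGeometry.HodgeTheory
open Literature.AlgebraicGeometry.Motives
open Literature.AlgebraicGeometry.VanGeemen1994 (hodgeGroupOne mem_hodgeGroupOne_iff)

namespace Literature.AlgebraicGeometry.Milne1999

/-! ### §0 Plumbing (private) -/

section Plumbing

/-- `s ⊕ t` determines `s` and `t`. [cite: Milne1999LefschetzClasses, §1 p. 643 (V(A₁ × A₂) = V(A₁) ⊕ V(A₂))] -/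
private theorem prodBlockDiagEquiv_inj {X Y : AbelianVariety ℂ} {s s' : complexBetti X.X 1 ≃ₗ[ℂ] complexBetti X.X 1}
    {t t' : complexBetti Y.X 1 ≃ₗ[ℂ] complexBetti Y.X 1} (h : prodBlockDiagEquiv s t = prodBlockDiagEquiv s' t') :
    s = s' ∧ t = t' := by
  have e := congrArg LinearEquiv.toLinearMap h
  rw [coe_prodBlockDiagEquiv, coe_prodBlockDiagEquiv] at e
  refine ⟨LinearEquiv.toLinearMap_injective ?_, LinearEquiv.toLinearMap_injective ?_⟩
  · rw [← prodRestrictFst_prodBlockDiag s.toLinearMap t.toLinearMap, e, prodRestrictFst_prodBlockDiag]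
  · rw [← prodRestrictSnd_prodBlockDiag s.toLinearMap t.toLinearMap, e, prodRestrictSnd_prodBlockDiag]

end Plumbing

/-! ### §1 The restriction homomorphism `ρ : Hg(X × Y)(ℂ) → Hg(X)(ℂ) × Hg(Y)(ℂ)` -/

section Two

variable (X Y : AbelianVariety ℂ)

/-- **THE RESTRICTION HOMOMORPHISM `ρ : Hg(X × Y)(ℂ) → Hg(X)(ℂ) × Hg(Y)(ℂ)`, FOR ARBITRARY `X`, `Y`**: a group homomorphism with
`g₁ = ρ(g)₁,₁ ⊕ ρ(g)₂,₁` on `H¹(X × Y) = H¹(X) ⊕ H¹(Y)` — `g₁ ∈ C(X × Y) ⊗ ℂ ⊂ C(X) × C(Y)` is block diagonal (Milne §1 p. 643), its blocks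
lie in `Hg(X)|_{H¹}`, `Hg(Y)|_{H¹}` (the lane's `exists_eq_prodBlockDiagEquiv_of_mem_hodgeGroupOne_prod`), and `Hg(Z) ≅ Hg(Z)|_{H¹}` lifts them
to families. [cite: MoonenZarhin1999LowDim, §3 (3.1)] [cite: Milne1999LefschetzClasses, §1 p. 643] -/
theorem exists_hodgeGroup_prod_restrictHom :
    ∃ ρ : hodgeGroup (X.prod Y).dim (X.prod Y).X →* hodgeGroup X.dim X.X × hodgeGroup Y.dim Y.X,
      ∀ g : hodgeGroup (X.prod Y).dim (X.prod Y).X, g.1 1 = prodBlockDiagEquiv ((ρ g).1.1 1) ((ρ g).2.1 1) := by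
  classical
  -- `g ↦ g₁ ∈ C(X × Y)`, then the two blocks
  let ι : hodgeGroup (X.prod Y).dim (X.prod Y).X →* centralizerGroup (X.prod Y) :=
    ((Pi.evalMonoidHom (fun k : ℕ ↦ complexBetti (X.prod Y).X k ≃ₗ[ℂ] complexBetti (X.prod Y).X k) 1).comp
      (hodgeGroup (X.prod Y).dim (X.prod Y).X).subtype).codRestrict (centralizerGroup (X.prod Y))
        fun g ↦ hodgeGroupOne_le_centralizerGroup (mem_hodgeGroupOne_iff.2 ⟨g.1, g.2, rfl⟩)
  have hι : ∀ g : hodgeGroup (X.prod Y).dim (X.prod Y).X,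
      ((ι g : centralizerGroup (X.prod Y)) : complexBetti (X.prod Y).X 1 ≃ₗ[ℂ] complexBetti (X.prod Y).X 1) = g.1 1 := fun _ ↦ rfl
  let rX : hodgeGroup (X.prod Y).dim (X.prod Y).X →* (complexBetti X.X 1 ≃ₗ[ℂ] complexBetti X.X 1) :=
    (centralizerGroup.restrictFstHom X Y).comp ι
  let rY : hodgeGroup (X.prod Y).dim (X.prod Y).X →* (complexBetti Y.X 1 ≃ₗ[ℂ] complexBetti Y.X 1) :=
    (centralizerGroup.restrictSndHom X Y).comp ι
  have hblock : ∀ g : hodgeGroup (X.prod Y).dim (X.prod Y).X,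
      rX g ∈ (hodgeGroup X.dim X.X).map (Pi.evalMonoidHom (fun k : ℕ ↦ complexBetti X.X k ≃ₗ[ℂ] complexBetti X.X k) 1) ∧
      rY g ∈ (hodgeGroup Y.dim Y.X).map (Pi.evalMonoidHom (fun k : ℕ ↦ complexBetti Y.X k ≃ₗ[ℂ] complexBetti Y.X k) 1) ∧
      g.1 1 = prodBlockDiagEquiv (rX g) (rY g) := fun g ↦ by
    obtain ⟨s, hs, t, ht, hst⟩ :=
      exists_eq_prodBlockDiagEquiv_of_mem_hodgeGroupOne_prod X Y (mem_hodgeGroupOne_iff.2 ⟨g.1, g.2, rfl⟩)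
    have hmem : prodBlockDiagEquiv s t ∈ centralizerGroup (X.prod Y) := by rw [← hst]; exact (ι g).2
    have hιg : ι g = ⟨prodBlockDiagEquiv s t, hmem⟩ := Subtype.ext (by rw [hι]; exact hst)
    have e1 : rX g = s := by
      show centralizerGroup.restrictFstHom X Y (ι g) = s
      rw [hιg, centralizerGroup.restrictFstHom_prodBlockDiagEquiv]
    have e2 : rY g = t := by
      show centralizerGroup.restrictSndHom X Y (ι g) = t
      rw [hιg, centralizerGroup.restrictSndHom_prodBlockDiagEquiv]
    rw [e1, e2]
    exact ⟨hs, ht, hst⟩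
  -- lift the blocks to the families (`Hg(Z) ≅ Hg(Z)|_{H¹}`)
  let LX := MulEquiv.ofBijective _ (bijective_evalOne_subgroupMap_hodgeGroup X)
  let LY := MulEquiv.ofBijective _ (bijective_evalOne_subgroupMap_hodgeGroup Y)
  let ρX : hodgeGroup (X.prod Y).dim (X.prod Y).X →* hodgeGroup X.dim X.X :=
    LX.symm.toMonoidHom.comp (rX.codRestrict _ fun g ↦ (hblock g).1)
  let ρY : hodgeGroup (X.prod Y).dim (X.prod Y).X →* hodgeGroup Y.dim Y.X :=
    LY.symm.toMonoidHom.comp (rY.codRestrict _ fun g ↦ (hblock g).2.1)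
  have kX : ∀ g, (ρX g).1 1 = rX g := fun g ↦
    congrArg Subtype.val (LX.apply_symm_apply ⟨rX g, (hblock g).1⟩)
  have kY : ∀ g, (ρY g).1 1 = rY g := fun g ↦
    congrArg Subtype.val (LY.apply_symm_apply ⟨rY g, (hblock g).2.1⟩)
  refine ⟨ρX.prod ρY, fun g ↦ ?_⟩
  show g.1 1 = prodBlockDiagEquiv ((ρX g).1 1) ((ρY g).1 1)
  rw [kX, kY]
  exact (hblock g).2.2

variable {X Y} {ρ ρ' : hodgeGroup (X.prod Y).dim (X.prod Y).X →* hodgeGroup X.dim X.X × hodgeGroup Y.dim Y.X}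

/-- **Uniqueness** of a homomorphism `ρ` with `g₁ = ρ(g)₁,₁ ⊕ ρ(g)₂,₁` (blocks are unique; elements of `Hg` are determined by their
`H¹`-components). [cite: MoonenZarhin1999LowDim, §3 (3.1)] [cite: vanGeemen1994HodgeAV, 6.4–6.5] -/
theorem hodgeGroup_prod_restrictHom_unique
    (hρ : ∀ g : hodgeGroup (X.prod Y).dim (X.prod Y).X, g.1 1 = prodBlockDiagEquiv ((ρ g).1.1 1) ((ρ g).2.1 1))
    (hρ' : ∀ g : hodgeGroup (X.prod Y).dim (X.prod Y).X, g.1 1 = prodBlockDiagEquiv ((ρ' g).1.1 1) ((ρ' g).2.1 1)) :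
    ρ = ρ' := by
  refine MonoidHom.ext fun g ↦ ?_
  obtain ⟨e1, e2⟩ := prodBlockDiagEquiv_inj ((hρ g).symm.trans (hρ' g))
  exact Prod.ext (Subtype.ext (hodgeGroup_ext_one (ρ g).1.2 (ρ' g).1.2 e1))
    (Subtype.ext (hodgeGroup_ext_one (ρ g).2.2 (ρ' g).2.2 e2))

/-- **«`Hg(X)` is an algebraic subgroup of `Hg(X_1) × Hg(X_2)`» on the complex points: the restriction homomorphism is INJECTIVE**
(`g = ⋀•g₁` is determined by `g₁`). [cite: MoonenZarhin1999LowDim, §3 (3.1)] [cite: Milne1999LefschetzClasses, §1 p. 643] -/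
theorem hodgeGroup_prod_restrictHom_injective
    (hρ : ∀ g : hodgeGroup (X.prod Y).dim (X.prod Y).X, g.1 1 = prodBlockDiagEquiv ((ρ g).1.1 1) ((ρ g).2.1 1)) :
    Function.Injective ρ := fun g g' h ↦ by
  refine Subtype.ext (hodgeGroup_ext_one g.2 g'.2 ?_)
  rw [hρ g, hρ g', h]

/-! ### §2 `ρ` is surjective iff `Hg(X × Y)` splits iff the (3.1) span condition holds -/

/-- **`ρ` IS SURJECTIVE IFF `Hg(X × Y)` SPLITS**, i.e. iff every block-diagonal `⋀•(u ⊕ v)` with `u ∈ Hg(X)|_{H¹}`, `v ∈ Hg(Y)|_{H¹}` lies in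
`Hg(X × Y)` (the converse containment holds always, §1). [cite: MoonenZarhin1999LowDim, §3 (3.1)] -/
theorem hodgeGroup_prod_restrictHom_surjective_iff
    (hρ : ∀ g : hodgeGroup (X.prod Y).dim (X.prod Y).X, g.1 1 = prodBlockDiagEquiv ((ρ g).1.1 1) ((ρ g).2.1 1)) :
    Function.Surjective ρ ↔
      ∀ u ∈ hodgeGroupOne X.dim X.X, ∀ v ∈ hodgeGroupOne Y.dim Y.X,
        (fun k ↦ exteriorPullbackEquiv (AbelianVariety.hasExteriorCohomologyH1_complexPoints (X.prod Y)) (prodBlockDiagEquiv u v) k) ∈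
          hodgeGroup (X.prod Y).dim (X.prod Y).X := by
  constructor
  · intro hsurj u hu v hv
    obtain ⟨s, hs, rfl⟩ := mem_hodgeGroupOne_iff.1 hu
    obtain ⟨t, ht, rfl⟩ := mem_hodgeGroupOne_iff.1 hv
    obtain ⟨g, hg⟩ := hsurj (⟨s, hs⟩, ⟨t, ht⟩)
    have h1 : g.1 1 = prodBlockDiagEquiv (s 1) (t 1) := by rw [hρ g, hg]
    rw [← h1, ← hodgeGroup_eq_exteriorPullbackEquiv g.2]
    exact g.2
  · rintro hsplit ⟨s, t⟩
    have hG := hsplit (s.1 1) (mem_hodgeGroupOne_iff.2 ⟨s.1, s.2, rfl⟩) (t.1 1) (mem_hodgeGroupOne_iff.2 ⟨t.1, t.2, rfl⟩)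
    refine ⟨⟨_, hG⟩, ?_⟩
    have key := hρ ⟨_, hG⟩
    rw [show (⟨_, hG⟩ : hodgeGroup (X.prod Y).dim (X.prod Y).X).1 1 = prodBlockDiagEquiv (s.1 1) (t.1 1) from
      exteriorPullbackEquiv_one_eq _ _] at key
    obtain ⟨e1, e2⟩ := prodBlockDiagEquiv_inj key
    exact Prod.ext (Subtype.ext (hodgeGroup_ext_one (ρ _).1.2 s.2 e1.symm)) (Subtype.ext (hodgeGroup_ext_one (ρ _).2.2 t.2 e2.symm))

/-- **MOONEN–ZARHIN (3.1) FOR THE RESTRICTION HOMOMORPHISM**: `ρ` is surjective (equivalently bijective, §1) iff for every `a` the Hodge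
classes of `X^{a+1} × Y^{a+1}` are spanned by the exterior products of Hodge classes (the lane's criterion
`forall_prodBlockDiagEquiv_mem_hodgeGroup_iff_forall_hodgeClassesProductSpan_powSucc`). [cite: MoonenZarhin1999LowDim, §1 and §3 (3.1)] -/
theorem hodgeGroup_prod_restrictHom_surjective_iff_forall_hodgeClassesProductSpan_powSucc
    (hρ : ∀ g : hodgeGroup (X.prod Y).dim (X.prod Y).X, g.1 1 = prodBlockDiagEquiv ((ρ g).1.1 1) ((ρ g).2.1 1)) :
    Function.Surjective ρ ↔ ∀ a : ℕ, HodgeClassesProductSpan (X.powSucc a) (Y.powSucc a) := by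
  rw [hodgeGroup_prod_restrictHom_surjective_iff hρ]
  exact forall_prodBlockDiagEquiv_mem_hodgeGroup_iff_forall_hodgeClassesProductSpan_powSucc X Y

/-- **Under splitting, `Hg(X × Y)(ℂ) ≅ Hg(X)(ℂ) × Hg(Y)(ℂ)`** (the restriction homomorphism is then bijective).
[cite: MoonenZarhin1999LowDim, §3 (3.1)] -/
theorem nonempty_hodgeGroup_prod_mulEquiv_prod_of_forall
    (hsplit : ∀ u ∈ hodgeGroupOne X.dim X.X, ∀ v ∈ hodgeGroupOne Y.dim Y.X,
      (fun k ↦ exteriorPullbackEquiv (AbelianVariety.hasExteriorCohomologyH1_complexPoints (X.prod Y)) (prodBlockDiagEquiv u v) k) ∈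
        hodgeGroup (X.prod Y).dim (X.prod Y).X) :
    Nonempty (hodgeGroup (X.prod Y).dim (X.prod Y).X ≃* hodgeGroup X.dim X.X × hodgeGroup Y.dim Y.X) := by
  obtain ⟨ρ, hρ⟩ := exists_hodgeGroup_prod_restrictHom X Y
  exact ⟨MulEquiv.ofBijective ρ ⟨hodgeGroup_prod_restrictHom_injective hρ, (hodgeGroup_prod_restrictHom_surjective_iff hρ).2 hsplit⟩⟩

/-- `Hg(X × Y)(ℂ) ≅ Hg(X)(ℂ) × Hg(Y)(ℂ)` when the (3.1) span condition holds for all `X^{a+1} × Y^{a+1}`. [cite: MoonenZarhin1999LowDim, §3 (3.1)] -/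
theorem nonempty_hodgeGroup_prod_mulEquiv_prod_of_forall_hodgeClassesProductSpan_powSucc
    (h : ∀ a : ℕ, HodgeClassesProductSpan (X.powSucc a) (Y.powSucc a)) :
    Nonempty (hodgeGroup (X.prod Y).dim (X.prod Y).X ≃* hodgeGroup X.dim X.X × hodgeGroup Y.dim Y.X) :=
  nonempty_hodgeGroup_prod_mulEquiv_prod_of_forall
    ((forall_prodBlockDiagEquiv_mem_hodgeGroup_iff_forall_hodgeClassesProductSpan_powSucc X Y).2 h)

end Two

/-! ### §3 Every number of factors: `Hg(⨁ᵢ Aᵢ)(ℂ) ↪ ∏ᵢ Hg(Aᵢ)(ℂ)`, and `Hg(X)(ℂ) ↪ ∏ᵢ Hg(Aᵢ)(ℂ)` for `X ∼ ⨁ᵢ Aᵢ^{rᵢ+1}` -/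

section Finite

/-- **`Hg(⨁ᵢ Aᵢ)(ℂ) ↪ ∏ᵢ Hg(Aᵢ)(ℂ)` FOR EVERY FINITE FAMILY** (no hypothesis on the factors): an injective group homomorphism, by
induction on the number of factors — `⨁ A ∼ A₀ × ⨁_{i≥1} Aᵢ` (the isogeny invariance `nonempty_hodgeGroup_mulEquiv_of_isIsogenous`), the
two-factor restriction of §1, and the induction hypothesis. [cite: MoonenZarhin1999LowDim, §3 (3.1)] [cite: Milne1999LefschetzClasses, §1 p. 643] -/
theorem exists_hodgeGroup_biproduct_restrictHom :
    ∀ {n : ℕ} (A : Fin (n + 1) → AbelianVariety ℂ),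
      ∃ ρ : hodgeGroup (⨁ A).dim (⨁ A).X →* ∀ i, hodgeGroup (A i).dim (A i).X, Function.Injective ρ
  | 0, A => by
    obtain ⟨e⟩ := nonempty_hodgeGroup_mulEquiv_of_isIsogenous
      (⟨_, isIsogeny_biproduct_π_fin_one A⟩ : AbelianVariety.IsIsogenous (⨁ A) (A 0))
    let c : ∀ i : Fin 1, hodgeGroup (⨁ A).dim (⨁ A).X →* hodgeGroup (A i).dim (A i).X := fun i ↦
      Fin.cases (motive := fun i ↦ hodgeGroup (⨁ A).dim (⨁ A).X →* hodgeGroup (A i).dim (A i).X) e.toMonoidHom (fun j ↦ j.elim0) i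
    exact ⟨MonoidHom.pi c, fun g g' h ↦ e.injective (congrFun h 0)⟩
  | n + 1, A => by
    obtain ⟨ρT, hTinj⟩ := exists_hodgeGroup_biproduct_restrictHom (fun j : Fin (n + 1) ↦ A j.succ)
    obtain ⟨e⟩ := nonempty_hodgeGroup_mulEquiv_of_isIsogenous
      (⟨_, isIsogeny_biproductSuccSplit A⟩ : AbelianVariety.IsIsogenous (⨁ A) ((A 0).prod (⨁ fun j : Fin (n + 1) ↦ A j.succ)))
    obtain ⟨ρ₂, hρ₂⟩ := exists_hodgeGroup_prod_restrictHom (A 0) (⨁ fun j : Fin (n + 1) ↦ A j.succ)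
    let c₀ : hodgeGroup (⨁ A).dim (⨁ A).X →* hodgeGroup (A 0).dim (A 0).X := (MonoidHom.fst _ _).comp (ρ₂.comp e.toMonoidHom)
    let cs : ∀ j : Fin (n + 1), hodgeGroup (⨁ A).dim (⨁ A).X →* hodgeGroup (A j.succ).dim (A j.succ).X := fun j ↦
      (Pi.evalMonoidHom (fun j : Fin (n + 1) ↦ hodgeGroup (A j.succ).dim (A j.succ).X) j).comp
        (ρT.comp ((MonoidHom.snd _ _).comp (ρ₂.comp e.toMonoidHom)))
    let ρ : hodgeGroup (⨁ A).dim (⨁ A).X →* ∀ i, hodgeGroup (A i).dim (A i).X :=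
      MonoidHom.pi fun i ↦ Fin.cases (motive := fun i ↦ hodgeGroup (⨁ A).dim (⨁ A).X →* hodgeGroup (A i).dim (A i).X) c₀ cs i
    have hρ0 : ∀ g, ρ g 0 = (ρ₂ (e g)).1 := fun _ ↦ rfl
    have hρs : ∀ g (j : Fin (n + 1)), ρ g j.succ = ρT (ρ₂ (e g)).2 j := fun _ _ ↦ rfl
    refine ⟨ρ, fun g g' hgg ↦ e.injective (hodgeGroup_prod_restrictHom_injective hρ₂ (Prod.ext ?_ (hTinj (funext fun j ↦ ?_))))⟩
    · rw [← hρ0, ← hρ0, hgg]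
    · rw [← hρs, ← hρs, hgg]

variable {n : ℕ} {X : AbelianVariety ℂ}

/-- **`Hg(X)(ℂ) ↪ ∏ᵢ Hg(Aᵢ)(ℂ)` FOR EVERY `X ∼ ⨁ᵢ Aᵢ^{rᵢ+1}`** (no hypothesis on the factors): isogeny invariance,
`Hg(⨁ᵢ Aᵢ^{rᵢ+1}) ≅ Hg(⨁ᵢ Aᵢ)` (Moonen–Zarhin §1, the lane's `nonempty_hodgeGroup_biproduct_mulEquiv_biproduct_powSucc`) and §3.
[cite: MoonenZarhin1999LowDim, §1 and §3 (3.1)] -/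
theorem exists_hodgeGroup_restrictHom_of_isIsogenous_biproduct_powSucc (A : Fin (n + 1) → AbelianVariety ℂ) (r : Fin (n + 1) → ℕ)
    (hX : AbelianVariety.IsIsogenous X (⨁ fun i ↦ (A i).powSucc (r i))) :
    ∃ ρ : hodgeGroup X.dim X.X →* ∀ i, hodgeGroup (A i).dim (A i).X, Function.Injective ρ := by
  obtain ⟨e₁⟩ := nonempty_hodgeGroup_mulEquiv_of_isIsogenous hX
  obtain ⟨e₂⟩ := nonempty_hodgeGroup_biproduct_mulEquiv_biproduct_powSucc A r
  obtain ⟨ρ, hinj⟩ := exists_hodgeGroup_biproduct_restrictHom A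
  exact ⟨ρ.comp (e₁.trans e₂.symm).toMonoidHom, hinj.comp (e₁.trans e₂.symm).injective⟩

/-- **`Hg(X)(ℂ)` is commutative as soon as every `Hg(Aᵢ)(ℂ)` is, for `X ∼ ⨁ᵢ Aᵢ^{rᵢ+1}`** (it embeds in `∏ᵢ Hg(Aᵢ)(ℂ)`).
[cite: MoonenZarhin1999LowDim, §3 (3.1)] -/
theorem forall_mul_comm_hodgeGroup_of_forall_of_isIsogenous_biproduct_powSucc (A : Fin (n + 1) → AbelianVariety ℂ) (r : Fin (n + 1) → ℕ)
    (hX : AbelianVariety.IsIsogenous X (⨁ fun i ↦ (A i).powSucc (r i)))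
    (hA : ∀ (i : Fin (n + 1)) (g h : hodgeGroup (A i).dim (A i).X), g * h = h * g) (g h : hodgeGroup X.dim X.X) :
    g * h = h * g := by
  obtain ⟨ρ, hinj⟩ := exists_hodgeGroup_restrictHom_of_isIsogenous_biproduct_powSucc A r hX
  exact hinj (by rw [map_mul, map_mul]; exact funext fun i ↦ hA i _ _)

end Finite

end Literature.AlgebraicGeometry.Milne1999
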